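import Summits.Ventures.HSemireg.WedgeHankelRecurrenceGaussChristoffelProduct

/-!
# Venture HSemireg — **THE STRUCTURE RELATION OF THE GENERAL JACOBI RECURRENCE** (`α, β > −1`, monic `P̃^{(α,β)}`): with the recurrence data of N402 (`a_0 = (β−α)∕(σ+2)`,
# `a_n = (β²−α²)∕((2n+σ)(2n+σ+2))`, `b_1 = 4(1+α)(1+β)∕((σ+2)²(σ+3))`, `b_n = 4n(n+α)(n+β)(n+σ)∕((2n+σ−1)(2n+σ)²(2n+σ+1))`, `σ = α+β`) one has, FROM THE RECURRENCE ALONE,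
# **`(X² − 1) q_n′ = (n X + d_n) q_n − e_n q_{n−1}`**, `d_n = n(β−α)∕(2n+σ)`, `e_n = (2n+σ+1) b_n` (the monic form of Szegő's (4.5.7)); the proof runs on the three rational identities
# `d_{n+1} − d_n = a_n`, `e_{n+2} − (2n+σ+1) b_{n+1} = 1 − a_{n+1}²`, `(2n+σ+5) a_{n+2} + d_{n+3} = (2n+σ+3) a_{n+1} + d_{n+1}`

HONEST FRAMING. Part of the Lean index of the computation cell `pub-hsemireg` (seat p10 gen 47, Sunday typer «UNIFORM-IN-n»).  Rational identities and polynomial algebra over `ℝ` only; no variety, no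
cohomology theory, no sheaf, no Ext group and no semiregularity map is constructed here; nothing here says that HC / HC_CM / HC_AV holds; no Literature fact (unproved `Prop`) is declared or used.
Custodian versions as in `WedgeHankelSiegelIdeal` (1/3).
SOURCES (cited).  G. Szegő, *Orthogonal Polynomials*, (4.5.1) (recurrence), (4.5.7) (`(2n+α+β)(1−x²) P_n′ = −n[(2n+α+β)x + β−α] P_n + 2(n+α)(n+β) P_{n−1}`), (4.21.6) (leading coefficient
`k_n = 2^{−n} binom(2n+α+β, n)`); M. E. H. Ismail, *Classical and Quantum Orthogonal Polynomials* (2005), (3.3.16) ∕ Thm 3.3.5 (lowering operator for Jacobi); NIST DLMF 18.9.17.  Monic form: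
dividing (4.5.7) by `(2n+σ) k_n` and using `k_{n−1}∕k_n = 2n(n+σ)∕((2n+σ−1)(2n+σ))` gives the coefficient `(2n+σ+1) b_n` of `q_{n−1}`.
PROOF TYPED HERE.  Two-step induction on `(S_{n+1}, S_{n+2})`, `S_m : (X²−1) q_m′ = (mX + d_m) q_m − e_m q_{m−1}`: the step differentiates the recurrence, substitutes `S_{n+1}, S_{n+2}`, eliminates
`q_n` with the recurrence (`e_{n+1} q_n = (2n+σ+3)((X − a_{n+1}) q_{n+1} − q_{n+2})`) and closes by `linear_combination` with the three scalar identities pushed through `C`; the base `S_1, S_2`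
uses `d_1 = a_0`, `(σ+3) b_1 = 1 − a_0²`, `d_2 = a_0 + a_1`, `e_2 = 1 − a_1² + (σ+1) b_1`, `(σ+4) a_1 = σ a_0`.  All scalar identities by `field_simp; ring` (denominators positive for `α, β > −1`).
DEDUP DISCLOSURE (`rg -n -i 'jacobi_structure|structure_relation' Summits/Ventures/HSemireg/WedgeHankelRecurrenceGauss*`, 2026-09-04): N392 `gegenbauer_structure_relation` (`α = β`), N389
`laguerre_structure_relation`; the general `(α, β)` relation is new; 0 hits for the 3 names below.

WHAT IS IN THE TREE.  N402 `jacobi_rates_identities ∕ jacobi_zeros_mem` (same recurrence data); N392 (the `α = β` template).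
THIS FILE (namespace `Summit.Ventures.HSemireg.Wedge.HankelOuter` continued; CHAINED on N410 (import only); 0 definitions):
* §1176 `jacobi_scalar_identities` (the four base ∕ three general rational identities among `a, b, d, e`), `jacobi_structure_pair` (`S_{n+1} ∧ S_{n+2}` for all `n`, base `S_1 ∧ S_2` included),
  **`jacobi_structure_relation`** (`(X² − 1) q_{n+1}′ = ((n+1) X + (n+1)(β−α)∕(2n+2+σ)) q_{n+1} − (2n+σ+3) b_{n+1} q_n`).
CAVEATS.  `α, β > −1` (all denominators `2m + σ + 2`, `σ + 3`, … are then positive); `a_0`, `b_1` in their cancelled forms as in N402.  Nothing Ext-side.  New names only.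
-/

open Module Polynomial
open scoped Matrix Polynomial

namespace Summit.Ventures.HSemireg.Wedge.HankelOuter

/-! ## §1176. The Jacobi structure relation -/

/-- **THE RATIONAL IDENTITIES BEHIND THE JACOBI STRUCTURE RELATION** (`d_m = m(β−α)∕(2m+σ)`, `e_m = (2m+σ+1) b_m`): `d_1 = a_0`, `(σ+3) b_1 = 1 − a_0²`, `(σ+4) a_1 = σ a_0`,
`e_2 = 1 − a_1² + (σ+1) b_1`, and for all `m`: `d_{m+2} = d_{m+1} + a_{m+1}`, `e_{m+3} = (2m+σ+3) b_{m+2} + 1 − a_{m+2}²`, `(2m+σ+5) a_{m+2} + d_{m+3} = (2m+σ+3) a_{m+1} + d_{m+1}`.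
[Szegő (4.5.1), (4.5.7); this file, §1176] -/
theorem jacobi_scalar_identities {a b : ℕ → ℝ} {α β : ℝ} (hα : -1 < α) (hβ : -1 < β) (ha0 : a 0 = (β - α) / (α + β + 2))
    (ha : ∀ n : ℕ, a (n + 1) = (β ^ 2 - α ^ 2) / ((2 * n + 2 + (α + β)) * (2 * n + 4 + (α + β))))
    (hb1 : b 1 = 4 * (1 + α) * (1 + β) / ((α + β + 2) ^ 2 * (α + β + 3)))
    (hb : ∀ n : ℕ, b (n + 2) = 4 * ((n : ℝ) + 2) * ((n : ℝ) + 2 + α) * ((n : ℝ) + 2 + β) * ((n : ℝ) + 2 + (α + β)) /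
      ((2 * n + 3 + (α + β)) * (2 * n + 4 + (α + β)) ^ 2 * (2 * n + 5 + (α + β))))
    {d e : ℕ → ℝ} (hd : ∀ m, d m = (m : ℝ) * (β - α) / (2 * (m : ℝ) + (α + β))) (he : ∀ m, e m = (2 * (m : ℝ) + 1 + (α + β)) * b m) :
    (d 1 = a 0 ∧ (α + β + 3) * b 1 = 1 - a 0 ^ 2 ∧ (α + β + 4) * a 1 = (α + β) * a 0 ∧ e 2 = 1 - a 1 ^ 2 + (α + β + 1) * b 1) ∧
      (∀ m : ℕ, d (m + 2) = d (m + 1) + a (m + 1)) ∧ (∀ m : ℕ, e (m + 3) = (2 * (m : ℝ) + 3 + (α + β)) * b (m + 2) + 1 - a (m + 2) ^ 2) ∧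
      ∀ m : ℕ, (2 * (m : ℝ) + 5 + (α + β)) * a (m + 2) + d (m + 3) = (2 * (m : ℝ) + 3 + (α + β)) * a (m + 1) + d (m + 1) := by
  have h2 : α + β + 2 ≠ 0 := by linarith
  have h3 : α + β + 3 ≠ 0 := by linarith
  have h4 : α + β + 4 ≠ 0 := by linarith
  have h5 : α + β + 5 ≠ 0 := by linarith
  -- canonical closed forms
  have hn : ∀ (m : ℕ) (k : ℝ), 2 ≤ k → 2 * (m : ℝ) + k + (α + β) ≠ 0 := fun m k hk => by
    have h0 : (0 : ℝ) ≤ m := Nat.cast_nonneg m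
    linarith
  have hD1 : ∀ m : ℕ, d (m + 1) = ((m : ℝ) + 1) * (β - α) / (2 * (m : ℝ) + 2 + (α + β)) := fun m => by
    rw [hd]; push_cast; rw [div_eq_div_iff (by have := hn m 2 (by norm_num); intro h; apply this; linarith) (hn m 2 (by norm_num))]; ring
  have hD2 : ∀ m : ℕ, d (m + 2) = ((m : ℝ) + 2) * (β - α) / (2 * (m : ℝ) + 4 + (α + β)) := fun m => by
    rw [hd]; push_cast; rw [div_eq_div_iff (by have := hn m 4 (by norm_num); intro h; apply this; linarith) (hn m 4 (by norm_num))]; ring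
  have hD3 : ∀ m : ℕ, d (m + 3) = ((m : ℝ) + 3) * (β - α) / (2 * (m : ℝ) + 6 + (α + β)) := fun m => by
    rw [hd]; push_cast; rw [div_eq_div_iff (by have := hn m 6 (by norm_num); intro h; apply this; linarith) (hn m 6 (by norm_num))]; ring
  have hA2 : ∀ m : ℕ, a (m + 2) = (β ^ 2 - α ^ 2) / ((2 * (m : ℝ) + 4 + (α + β)) * (2 * (m : ℝ) + 6 + (α + β))) := fun m => by
    rw [show m + 2 = m + 1 + 1 from rfl, ha (m + 1)]; push_cast
    rw [div_eq_div_iff (mul_ne_zero (by have := hn m 4 (by norm_num); intro h; apply this; linarith) (by have := hn m 6 (by norm_num); intro h; apply this; linarith))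
      (mul_ne_zero (hn m 4 (by norm_num)) (hn m 6 (by norm_num)))]
    ring
  have hB3 : ∀ m : ℕ, b (m + 3) = 4 * ((m : ℝ) + 3) * ((m : ℝ) + 3 + α) * ((m : ℝ) + 3 + β) * ((m : ℝ) + 3 + (α + β)) /
      ((2 * (m : ℝ) + 5 + (α + β)) * (2 * (m : ℝ) + 6 + (α + β)) ^ 2 * (2 * (m : ℝ) + 7 + (α + β))) := fun m => by
    rw [show m + 3 = m + 1 + 2 from rfl, hb (m + 1)]; push_cast
    rw [div_eq_div_iff (mul_ne_zero (mul_ne_zero (by have := hn m 5 (by norm_num); intro h; apply this; linarith)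
      (pow_ne_zero 2 (by have := hn m 6 (by norm_num); intro h; apply this; linarith))) (by have := hn m 7 (by norm_num); intro h; apply this; linarith))
      (mul_ne_zero (mul_ne_zero (hn m 5 (by norm_num)) (pow_ne_zero 2 (hn m 6 (by norm_num)))) (hn m 7 (by norm_num)))]
    ring
  refine ⟨⟨?_, ?_, ?_, ?_⟩, fun m => ?_, fun m => ?_, fun m => ?_⟩
  · rw [hD1, ha0]; push_cast; rw [zero_add, one_mul, show 2 * (0 : ℝ) + 2 + (α + β) = α + β + 2 by ring]
  · rw [hb1, ha0]; field_simp; ring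
  · have h1 := ha 0
    push_cast at h1
    rw [h1, ha0, show 2 * 0 + 2 + (α + β) = α + β + 2 by ring, show 2 * 0 + 4 + (α + β) = α + β + 4 by ring]
    field_simp; ring
  · have h1 := ha 0
    have h0 := hb 0
    push_cast at h1 h0
    rw [he, h0, h1, hb1]
    push_cast
    rw [show 2 * 0 + 2 + (α + β) = α + β + 2 by ring, show 2 * 0 + 4 + (α + β) = α + β + 4 by ring, show 2 * 0 + 3 + (α + β) = α + β + 3 by ring,
      show 2 * 0 + 5 + (α + β) = α + β + 5 by ring, show (2 * 2 + 1 + (α + β)) = α + β + 5 by ring]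
    field_simp; ring
  · have h6 := hn m 2 (by norm_num); have h7 := hn m 4 (by norm_num)
    rw [hD2, hD1, ha m, div_add_div _ _ h6 (mul_ne_zero h6 h7), div_eq_div_iff h7 (mul_ne_zero h6 (mul_ne_zero h6 h7))]
    ring
  · have h6 := hn m 3 (by norm_num); have h7 := hn m 4 (by norm_num); have h8 := hn m 5 (by norm_num); have h9 := hn m 6 (by norm_num); have h10 := hn m 7 (by norm_num)
    rw [he, hB3, hb m, hA2]
    push_cast
    rw [div_pow, eq_comm, ← sub_eq_zero]
    field_simp
    ring
  · have h6 := hn m 2 (by norm_num); have h7 := hn m 4 (by norm_num); have h9 := hn m 6 (by norm_num)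
    rw [hD3, hD1, hA2, ha m, mul_div_assoc', mul_div_assoc', div_add_div _ _ (mul_ne_zero h7 h9) h9, div_add_div _ _ (mul_ne_zero h6 h7) h6,
      div_eq_div_iff (mul_ne_zero (mul_ne_zero h7 h9) h9) (mul_ne_zero (mul_ne_zero h6 h7) h6)]
    ring

/-- **THE JACOBI STRUCTURE RELATION, every index: `S_{n+1} ∧ S_{n+2}`** with `S_m : (X²−1) q_m′ = (m X + d_m) q_m − e_m q_{m−1}`, `d_m = m(β−α)∕(2m+σ)`, `e_m = (2m+σ+1) b_m`. [Szegő (4.5.7),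
monic; this file, §1176] -/
theorem jacobi_structure_pair {q : ℕ → ℝ[X]} {a b : ℕ → ℝ} {α β : ℝ} (hq0 : q 0 = 1) (hq1 : q 1 = Polynomial.X - C (a 0))
    (hrec : ∀ n, q (n + 2) = (Polynomial.X - C (a (n + 1))) * q (n + 1) - C (b (n + 1)) * q n) (hα : -1 < α) (hβ : -1 < β) (ha0 : a 0 = (β - α) / (α + β + 2))
    (ha : ∀ n : ℕ, a (n + 1) = (β ^ 2 - α ^ 2) / ((2 * n + 2 + (α + β)) * (2 * n + 4 + (α + β))))
    (hb1 : b 1 = 4 * (1 + α) * (1 + β) / ((α + β + 2) ^ 2 * (α + β + 3)))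
    (hb : ∀ n : ℕ, b (n + 2) = 4 * ((n : ℝ) + 2) * ((n : ℝ) + 2 + α) * ((n : ℝ) + 2 + β) * ((n : ℝ) + 2 + (α + β)) /
      ((2 * n + 3 + (α + β)) * (2 * n + 4 + (α + β)) ^ 2 * (2 * n + 5 + (α + β))))
    {d e : ℕ → ℝ} (hd : ∀ m, d m = (m : ℝ) * (β - α) / (2 * (m : ℝ) + (α + β))) (he : ∀ m, e m = (2 * (m : ℝ) + 1 + (α + β)) * b m) (n : ℕ) :
    (Polynomial.X ^ 2 - 1) * derivative (q (n + 1)) = (((n : ℝ[X]) + 1) * Polynomial.X + C (d (n + 1))) * q (n + 1) - C (e (n + 1)) * q n ∧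
      (Polynomial.X ^ 2 - 1) * derivative (q (n + 2)) = (((n : ℝ[X]) + 2) * Polynomial.X + C (d (n + 2))) * q (n + 2) - C (e (n + 2)) * q (n + 1) := by
  obtain ⟨⟨hd1, hB1, h41, he2⟩, hI, hII, hIII⟩ := jacobi_scalar_identities hα hβ ha0 ha hb1 hb hd he
  induction n with
  | zero =>
    -- `S_1` and `S_2`
    have hd2 : d 2 = a 0 + a 1 := by rw [show (2 : ℕ) = 0 + 2 from rfl, hI 0, zero_add, hd1]
    have h2 : q 2 = (Polynomial.X - C (a 1)) * q 1 - C (b 1) * q 0 := hrec 0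
    have hB1' : (C α + C β + 3) * C (b 1) = 1 - C (a 0) ^ 2 := by
      have h := congrArg C hB1; simpa only [map_add, map_mul, map_sub, map_pow, map_one, map_ofNat] using h
    have h41' : (C α + C β + 4) * C (a 1) = (C α + C β) * C (a 0) := by
      have h := congrArg C h41; simpa only [map_add, map_mul, map_ofNat] using h
    constructor
    · rw [zero_add, hq1, hq0, hd1, show e 1 = 1 - a 0 ^ 2 by rw [he]; push_cast; rw [show 2 * 1 + 1 + (α + β) = α + β + 3 by ring]; exact hB1]
      simp only [derivative_X, derivative_C, sub_zero, mul_one, map_sub, map_one, map_pow, Nat.cast_zero, zero_add, one_mul]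
      ring
    · rw [zero_add, h2, hq1, hq0, hd2, he2]
      simp only [derivative_mul, derivative_X, derivative_C, sub_zero, mul_one, one_mul, map_sub, map_add, map_one, map_pow, map_mul, Nat.cast_zero, zero_add]
      linear_combination (Polynomial.X - C (a 1)) * hB1' + C (b 1) * h41'
  | succ n ih =>
    obtain ⟨ih1, ih2⟩ := ih
    refine ⟨by rw [show n + 1 + 1 = n + 2 from rfl]; push_cast; rw [show (n : ℝ[X]) + 1 + 1 = (n : ℝ[X]) + 2 by ring]; exact ih2, ?_⟩
    rw [show n + 1 + 2 = n + 3 from rfl, show n + 1 + 1 = n + 2 from rfl]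
    have h3 : q (n + 3) = (Polynomial.X - C (a (n + 2))) * q (n + 2) - C (b (n + 2)) * q (n + 1) := hrec (n + 1)
    have h2 : q (n + 2) = (Polynomial.X - C (a (n + 1))) * q (n + 1) - C (b (n + 1)) * q n := hrec n
    have hdq : derivative (q (n + 3)) = q (n + 2) + (Polynomial.X - C (a (n + 2))) * derivative (q (n + 2)) - C (b (n + 2)) * derivative (q (n + 1)) := by
      rw [h3]; simp only [derivative_sub, derivative_mul, derivative_X, derivative_C, sub_zero, one_mul, zero_mul, zero_add]
    -- the scalar identities, pushed through `C`
    have hE1 : C (e (n + 1)) = (2 * (n : ℝ[X]) + 3 + (C α + C β)) * C (b (n + 1)) := by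
      rw [he]; push_cast; simp only [map_add, map_mul, map_one, map_natCast, map_ofNat]; ring
    have hE2 : C (e (n + 2)) = (2 * (n : ℝ[X]) + 5 + (C α + C β)) * C (b (n + 2)) := by
      rw [he]; push_cast; simp only [map_add, map_mul, map_one, map_natCast, map_ofNat]; ring
    have hIC : C (d (n + 3)) = C (d (n + 2)) + C (a (n + 2)) := by rw [show n + 3 = (n + 1) + 2 from rfl, hI (n + 1), map_add]
    have hIIC : C (e (n + 3)) = (2 * (n : ℝ[X]) + 3 + (C α + C β)) * C (b (n + 2)) + 1 - C (a (n + 2)) ^ 2 := by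
      have h := congrArg C (hII n); simpa only [map_add, map_sub, map_mul, map_pow, map_one, map_natCast, map_ofNat] using h
    have hIIIC : (2 * (n : ℝ[X]) + 5 + (C α + C β)) * C (a (n + 2)) + C (d (n + 3)) = (2 * (n : ℝ[X]) + 3 + (C α + C β)) * C (a (n + 1)) + C (d (n + 1)) := by
      have h := congrArg C (hIII n); simpa only [map_add, map_mul, map_natCast, map_ofNat] using h
    push_cast
    rw [hdq, h3]
    linear_combination (Polynomial.X - C (a (n + 2))) * ih2 - C (b (n + 2)) * ih1 + ((2 * (n : ℝ[X]) + 3 + (C α + C β)) * C (b (n + 2))) * h2 +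
      (C (b (n + 2)) * q n) * hE1 + (C (a (n + 2)) * q (n + 1) - Polynomial.X * q (n + 1)) * hE2 + (C (a (n + 2)) * q (n + 2) - Polynomial.X * q (n + 2)) * hIC +
      (q (n + 2)) * hIIC + (C (b (n + 2)) * q (n + 1)) * hIIIC

/-- **THE MONIC JACOBI STRUCTURE RELATION: `(X² − 1) q_{n+1}′ = ((n+1) X + (n+1)(β−α)∕(2(n+1)+σ)) q_{n+1} − (2(n+1)+σ+1) b_{n+1} q_n`** (`α, β > −1`, recurrence data of N402).
[Szegő (4.5.7); Ismail (3.3.16); DLMF 18.9.17; this file, §1176] -/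
theorem jacobi_structure_relation {q : ℕ → ℝ[X]} {a b : ℕ → ℝ} {α β : ℝ} (hq0 : q 0 = 1) (hq1 : q 1 = Polynomial.X - C (a 0))
    (hrec : ∀ n, q (n + 2) = (Polynomial.X - C (a (n + 1))) * q (n + 1) - C (b (n + 1)) * q n) (hα : -1 < α) (hβ : -1 < β) (ha0 : a 0 = (β - α) / (α + β + 2))
    (ha : ∀ n : ℕ, a (n + 1) = (β ^ 2 - α ^ 2) / ((2 * n + 2 + (α + β)) * (2 * n + 4 + (α + β))))
    (hb1 : b 1 = 4 * (1 + α) * (1 + β) / ((α + β + 2) ^ 2 * (α + β + 3)))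
    (hb : ∀ n : ℕ, b (n + 2) = 4 * ((n : ℝ) + 2) * ((n : ℝ) + 2 + α) * ((n : ℝ) + 2 + β) * ((n : ℝ) + 2 + (α + β)) /
      ((2 * n + 3 + (α + β)) * (2 * n + 4 + (α + β)) ^ 2 * (2 * n + 5 + (α + β)))) (n : ℕ) :
    (Polynomial.X ^ 2 - 1) * derivative (q (n + 1)) =
      (C ((n : ℝ) + 1) * Polynomial.X + C (((n : ℝ) + 1) * (β - α) / (2 * ((n : ℝ) + 1) + (α + β)))) * q (n + 1) - C ((2 * ((n : ℝ) + 1) + 1 + (α + β)) * b (n + 1)) * q n := by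
  have h := (jacobi_structure_pair hq0 hq1 hrec hα hβ ha0 ha hb1 hb (d := fun m => (m : ℝ) * (β - α) / (2 * (m : ℝ) + (α + β)))
    (e := fun m => (2 * (m : ℝ) + 1 + (α + β)) * b m) (fun _ => rfl) (fun _ => rfl) n).1
  rw [h, map_add, map_one, map_natCast]
  push_cast
  ring

end Summit.Ventures.HSemireg.Wedge.HankelOuter
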